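import Summits.QuantumFields.YangMills.Theorems.AllWindowsColdBoxBoxHighLineGhostTaylor
import Summits.QuantumFields.YangMills.Theorems.AllWindowsColdBoxBoxHighLineGhostLogDetHS4
import Summits.QuantumFields.YangMills.Theorems.AllWindowsColdBoxBoxHighLineWilsonPlaquetteTaylorCore
import Summits.QuantumFields.YangMills.Theorems.AllWindowsColdBoxBoxHighLineStep2Tilt

/-!
# T-S5.7d⁽⁴⁾ `GhostTaylorEven`, PRELIMINARIES — matrix helpers, parity of the chart link split, and the pure-real bookkeeping `final_arith4`
# for `|(ghostLogRatio a + ghostLogRatio (−a))/2 − quadVal (ghostM H) a| ≤ C·H⁸·(1+log H)⁸·t⁴` (proved in `…GhostTaylorEven`)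

Free-hands brick of LEAD ym-line-sfw-p2 g78 for planner ym-idea-2 g18's ★FLAG-2 (2026-08-30T01:19:49Z; K3′ row RA-ghost of U5 = `stub_landauThirdOrder`,
⟨stmt-QuantumFields-24336⟩).  w3 g40's ✓`ghostTaylor` gives `|ghostLogRatio a − quadVal M_H a| ≤ C·H⁶(1+log H)⁴·t³`; the even symmetrisation kills the cubic
order.  Proof = the 7d assembly one order further, with NO third-order chart expansion: writing `X(±a) = ±X_A + X_B + X_R(±a)` (✓`fpOperator_edgeChart_sub_one`,
`chartL` odd, `chartQ` even), the symmetrised cubic chart remainder is already quartic — `chartR a e + chartR (−a) e = 2(cos‖v‖ − 1 + ‖v‖²/2)·1`, `‖·‖ ≤ (5/48)t⁴`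
(the `sinc` term is odd and cancels) — and

  `(g(a)+g(−a))/2 − quadVal = ½(r₄⁺ + r₄⁻) + ½tr(X_R⁺ + X_R⁻) − ½tr(X_A(X_R⁺ − X_R⁻)) − ¼(tr E₊² + tr E₋²) + ½(tr X_A²E₊ + tr X_A²E₋) + ½(tr X_AE₊² − tr X_AE₋²) + ⅙(tr E₊³ + tr E₋³)`

(`E± := X_B + X_R(±a)`, `tr X_A = 0` ✓`trace_ghostX_chartL`, `quadVal M_H a = tr X_B − ½tr X_A²` ✓`quadVal_ghostM`, `tr X_A³` cancels), where `r₄` is the THIRD-order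
log-det remainder ✓`LogDetHS.logDet_hs4` (`≤ (ρ²/2)‖X‖²_HS ≍ H⁴t²·H⁴(log)⁴t²` — the `H⁸`), and every other term is `≤ C·κ^{3/2}·t⁴`, `κ ≍ H⁴(1+log H)⁴`
(Hilbert–Schmidt sizes ✓`sum_sq_ghostX_le`, `|tr(PQ)| ≤ ‖P‖_HS‖Q‖_HS`, `‖PQ‖_HS ≤ ‖P‖_HS‖Q‖_HS`).

* `sum_sq_mul_le`, `abs_trace_mul_le_hs`, `abs_trace_mul_mul_le_hs`, `trace_cube_add` — matrix helpers;
* `chartL_neg`, `chartQ_neg`, `norm_chartR_add_chartR_neg_le`, `norm_chartR_sub_chartR_neg_le` — parity of the chart link split;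
* `ghostX_neg'`, `final_arith4` — plumbing and the real bookkeeping (the theorem itself is in `…GhostTaylorEven`).

Everything proved, Mathlib + tree only, standard axioms; no definitions.  HONEST LABEL: ONE brick of a K3′ row of an UNSTAFFED stub of a critic-PASSed DRAFT line;
U5, ⟨24004⟩, ⟨24336⟩ remain OPEN; no crux, rung or summit is proved; **the Yang–Mills mass gap is NOT proved by this file; no summit is proved by a line.**
-/

set_option autoImplicit false

noncomputable section

open Matrix Finset
open scoped Matrix.Norms.Operator
open Literature.MathematicalPhysics.QuantumFieldTheory.Balaban1983to89.B10Eq18SigmaSU2 (su2Coord)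
open Literature.MathematicalPhysics.QuantumFieldTheory.Balaban1983to89.B10Eq18SigmaSU2Haar (expPauli)
open Literature.MathematicalPhysics.QuantumFieldTheory.AxialGauge (boxEdges)
open Literature.MathematicalPhysics.QuantumLattice (LGConfig ZdEdge)
open Literature.Probability.LatticeModels (Site dirichletMatrix dirichletMatrix_transpose)

namespace Summit.QuantumFields.YangMills.Theorems.AllWindowsColdBoxBoxHighLine

namespace GhostTaylorProof

open GhostFP

variable {H : ℕ}

/-! ## Matrix helpers -/

/-- `‖PQ‖²_HS ≤ ‖P‖²_HS · ‖Q‖²_HS`. -/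
theorem sum_sq_mul_le {ι : Type*} [Fintype ι] (P Q : Matrix ι ι ℝ) :
    ∑ i, ∑ j, (P * Q) i j ^ 2 ≤ (∑ i, ∑ j, P i j ^ 2) * ∑ i, ∑ j, Q i j ^ 2 := by
  have hQ : ∑ i, ∑ j, Q i j ^ 2 = ∑ j, ∑ k, Q k j ^ 2 := Finset.sum_comm
  rw [hQ, Finset.sum_mul]
  refine Finset.sum_le_sum fun i _ => ?_
  rw [Finset.mul_sum]
  refine Finset.sum_le_sum fun j _ => ?_
  rw [Matrix.mul_apply]
  exact Finset.sum_mul_sq_le_sq_mul_sq Finset.univ (fun k => P i k) (fun k => Q k j)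

/-- `|tr(PQ)| ≤ √‖P‖²_HS · √‖Q‖²_HS`. -/
theorem abs_trace_mul_le_hs {ι : Type*} [Fintype ι] (P Q : Matrix ι ι ℝ) :
    |(P * Q).trace| ≤ Real.sqrt (∑ i, ∑ j, P i j ^ 2) * Real.sqrt (∑ i, ∑ j, Q i j ^ 2) := by
  rw [← Real.sqrt_mul (Finset.sum_nonneg fun i _ => Finset.sum_nonneg fun j _ => sq_nonneg _)]
  exact abs_trace_mul_le_sqrt P Q

/-- `|tr(PQR)| ≤ √‖P‖²_HS · √‖Q‖²_HS · √‖R‖²_HS`. -/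
theorem abs_trace_mul_mul_le_hs {ι : Type*} [Fintype ι] (P Q R : Matrix ι ι ℝ) :
    |(P * Q * R).trace| ≤ Real.sqrt (∑ i, ∑ j, P i j ^ 2) * Real.sqrt (∑ i, ∑ j, Q i j ^ 2) * Real.sqrt (∑ i, ∑ j, R i j ^ 2) := by
  rw [Matrix.mul_assoc]
  refine (abs_trace_mul_le_hs P (Q * R)).trans ?_
  rw [mul_assoc]
  refine mul_le_mul_of_nonneg_left ?_ (Real.sqrt_nonneg _)
  rw [← Real.sqrt_mul (Finset.sum_nonneg fun i _ => Finset.sum_nonneg fun j _ => sq_nonneg _)]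
  exact Real.sqrt_le_sqrt (sum_sq_mul_le Q R)

/-- `tr (A+E)³ = tr A³ + 3 tr(A²E) + 3 tr(AE²) + tr E³` (cyclicity of the trace). -/
theorem trace_cube_add {ι : Type*} [Fintype ι] (A E : Matrix ι ι ℝ) :
    ((A + E) * (A + E) * (A + E)).trace = (A * A * A).trace + 3 * (A * A * E).trace + 3 * (A * E * E).trace + (E * E * E).trace := by
  have c1 : (A * E * A).trace = (A * A * E).trace := by
    rw [Matrix.trace_mul_comm, ← Matrix.mul_assoc]
  have c2 : (E * A * A).trace = (A * A * E).trace := by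
    rw [Matrix.trace_mul_comm, ← Matrix.mul_assoc, c1]
  have c3 : (E * A * E).trace = (A * E * E).trace := by
    rw [Matrix.mul_assoc, Matrix.trace_mul_comm]
  have c4 : (E * E * A).trace = (A * E * E).trace := by
    rw [Matrix.trace_mul_comm, ← Matrix.mul_assoc]
  simp only [add_mul, mul_add, Matrix.trace_add]
  rw [c1, c2, c3, c4]
  ring

/-- `tr (A+E)² = tr A² + 2 tr(AE) + tr E²`. -/
theorem trace_sq_add {ι : Type*} [Fintype ι] (A E : Matrix ι ι ℝ) :
    ((A + E) * (A + E)).trace = (A * A).trace + 2 * (A * E).trace + (E * E).trace := by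
  simp only [add_mul, mul_add, Matrix.trace_add]
  rw [Matrix.trace_mul_comm E A]
  ring

/-! ## Parity of the chart link split -/

/-- `chartL (−a) = −chartL a`. -/
theorem chartL_neg (a : LandauFree H → E3) : chartL H (-a) = -chartL H a := by
  funext e
  simp only [chartL, Pi.neg_apply, WilsonTaylor.freeVec_neg, WithLp.ofLp_neg]
  exact Parity.su2Coord_neg (WithLp.ofLp (freeVec H a e))

/-- `chartQ (−a) = chartQ a`. -/
theorem chartQ_neg (a : LandauFree H → E3) : chartQ H (-a) = chartQ H a := by
  funext e
  simp only [chartQ, WilsonTaylor.freeVec_neg, norm_neg]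

/-- **The symmetrised cubic chart remainder is quartic**: `‖chartR a e + chartR (−a) e‖ ≤ (5/48)·‖a_e‖⁴` (the `sinc` term is odd and cancels; ‖a_e‖ ≤ 1). -/
theorem norm_chartR_add_chartR_neg_le (a : LandauFree H → E3) (e : ZdEdge 4) (hv : ‖freeVec H a e‖ ≤ 1) :
    ‖chartR H a e + chartR H (-a) e‖ ≤ 5 / 48 * ‖freeVec H a e‖ ^ 4 := by
  have hX : su2Coord (WithLp.ofLp (-freeVec H a e)) = -su2Coord (WithLp.ofLp (freeVec H a e)) := by
    rw [WithLp.ofLp_neg]; exact Parity.su2Coord_neg _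
  have hsum : chartR H a e + chartR H (-a) e =
      (((2 * (Real.cos ‖freeVec H a e‖ - 1 + ‖freeVec H a e‖ ^ 2 / 2) : ℝ) : ℂ)) • (1 : Matrix (Fin 2) (Fin 2) ℂ) := by
    simp only [chartR, WilsonTaylor.freeVec_neg, norm_neg, hX, smul_neg]
    rw [Complex.ofReal_mul, Complex.ofReal_ofNat, two_mul, add_smul]
    abel
  rw [hsum, norm_smul, norm_one, mul_one, Complex.norm_real, Real.norm_eq_abs]
  have h0 : 0 ≤ ‖freeVec H a e‖ := norm_nonneg _
  have hcos : |Real.cos ‖freeVec H a e‖ - 1 + ‖freeVec H a e‖ ^ 2 / 2| ≤ ‖freeVec H a e‖ ^ 4 * (5 / 96) := by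
    have h := Real.cos_bound (show |‖freeVec H a e‖| ≤ 1 by rw [abs_of_nonneg h0]; exact hv)
    rw [abs_of_nonneg h0] at h
    have eq : Real.cos ‖freeVec H a e‖ - 1 + ‖freeVec H a e‖ ^ 2 / 2 = Real.cos ‖freeVec H a e‖ - (1 - ‖freeVec H a e‖ ^ 2 / 2) := by ring
    rw [eq]; exact h
  rw [abs_mul, abs_two]
  linarith

/-- `‖chartR a e − chartR (−a) e‖ ≤ 2‖a_e‖³` (crude; ‖a_e‖ ≤ 1). -/
theorem norm_chartR_sub_chartR_neg_le (a : LandauFree H → E3) (e : ZdEdge 4) (hv : ‖freeVec H a e‖ ≤ 1) :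
    ‖chartR H a e - chartR H (-a) e‖ ≤ 2 * ‖freeVec H a e‖ ^ 3 := by
  have h1 : ‖chartR H a e‖ ≤ ‖freeVec H a e‖ ^ 3 := norm_chartRem_le (freeVec H a e) hv
  have h2 : ‖chartR H (-a) e‖ ≤ ‖freeVec H a e‖ ^ 3 := by
    have := norm_chartRem_le (freeVec H (-a) e) (by rw [WilsonTaylor.freeVec_neg, norm_neg]; exact hv)
    rw [WilsonTaylor.freeVec_neg, norm_neg] at this
    simpa [chartR, WilsonTaylor.freeVec_neg, norm_neg] using this
  linarith [norm_sub_le (chartR H a e) (chartR H (-a) e)]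

/-- `ghostX (−W) = −ghostX W`. -/
theorem ghostX_neg' (W : ZdEdge 4 → Matrix (Fin 2) (Fin 2) ℂ) : ghostX H (-W) = -ghostX H W := by
  rw [← neg_one_smul ℝ W, ghostX_smul, neg_one_smul]

/-- The pure real bookkeeping of `ghostTaylorEven`: all trace / remainder sizes in, `C·(κ² + κ + H⁴κ + CG·H⁴)·t⁴` out. -/
theorem final_arith4 {t κ ρ2 h4 CG sA sEp sEm sD r4p r4m trS tAD tEp2 tEm2 tAAEp tAAEm tAEEp tAEEm tE3p tE3m : ℝ}
    (ht0 : 0 ≤ t) (ht1 : t ≤ 1) (hκ : 0 ≤ κ) (hh4 : 0 ≤ h4) (hCG : 0 ≤ CG) (hρ2b : ρ2 ≤ 1806336 * h4 * t ^ 2)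
    (hsA0 : 0 ≤ sA) (hsA : sA ≤ 9 * κ * t ^ 2) (hsEp0 : 0 ≤ sEp) (hsEp : sEp ≤ 5 / 2 * κ * t ^ 4) (hsEm0 : 0 ≤ sEm) (hsEm : sEm ≤ 5 / 2 * κ * t ^ 4)
    (hsD : sD ≤ 4 * κ * t ^ 6)
    (hr4p : |r4p| ≤ ρ2 / 2 * (123 / 4 * κ * t ^ 2)) (hr4m : |r4m| ≤ ρ2 / 2 * (123 / 4 * κ * t ^ 2))
    (htrS : |trS| ≤ 144 * CG * (5 / 48 * t ^ 4) * h4)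
    (htAD : |tAD| ≤ Real.sqrt sA * Real.sqrt sD)
    (htEp2 : |tEp2| ≤ Real.sqrt sEp * Real.sqrt sEp) (htEm2 : |tEm2| ≤ Real.sqrt sEm * Real.sqrt sEm)
    (htAAEp : |tAAEp| ≤ Real.sqrt sA * Real.sqrt sA * Real.sqrt sEp) (htAAEm : |tAAEm| ≤ Real.sqrt sA * Real.sqrt sA * Real.sqrt sEm)
    (htAEEp : |tAEEp| ≤ Real.sqrt sA * Real.sqrt sEp * Real.sqrt sEp) (htAEEm : |tAEEm| ≤ Real.sqrt sA * Real.sqrt sEm * Real.sqrt sEm)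
    (htE3p : |tE3p| ≤ Real.sqrt sEp * Real.sqrt sEp * Real.sqrt sEp) (htE3m : |tE3m| ≤ Real.sqrt sEm * Real.sqrt sEm * Real.sqrt sEm) :
    |(r4p + r4m) / 2 + trS / 2 - tAD / 2 - (tEp2 + tEm2) / 4 + (tAAEp + tAAEm) / 2 + (tAEEp - tAEEm) / 2 + (tE3p + tE3m) / 6| ≤
      (27776916 * h4 * κ + 15 * CG * h4 + 60 * κ + 60 * κ ^ 2 + 60) * t ^ 4 := by
  have ht2 : t ^ 2 ≤ 1 := pow_le_one₀ ht0 ht1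
  have ht4 : 0 ≤ t ^ 4 := pow_nonneg ht0 4
  -- square roots
  have qA : Real.sqrt sA * Real.sqrt sA = sA := Real.mul_self_sqrt hsA0
  have qEp : Real.sqrt sEp * Real.sqrt sEp = sEp := Real.mul_self_sqrt hsEp0
  have qEm : Real.sqrt sEm * Real.sqrt sEm = sEm := Real.mul_self_sqrt hsEm0
  have w0 : 0 ≤ Real.sqrt κ := Real.sqrt_nonneg κ
  have wκ : Real.sqrt κ * Real.sqrt κ = κ := Real.mul_self_sqrt hκ
  have wle : Real.sqrt κ ≤ (1 + κ) / 2 := by nlinarith [Real.sq_sqrt hκ, sq_nonneg (Real.sqrt κ - 1), Real.sqrt_nonneg κ]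
  have rA : Real.sqrt sA ≤ 3 * Real.sqrt κ * t := by
    have h : sA ≤ (3 * Real.sqrt κ * t) ^ 2 := by
      rw [show (3 * Real.sqrt κ * t) ^ 2 = 9 * (Real.sqrt κ * Real.sqrt κ) * t ^ 2 by ring, wκ]; exact hsA
    exact (Real.sqrt_le_sqrt h).trans (le_of_eq (Real.sqrt_sq (by positivity)))
  have rE : ∀ {sE : ℝ}, sE ≤ 5 / 2 * κ * t ^ 4 → Real.sqrt sE ≤ 2 * Real.sqrt κ * t ^ 2 := by
    intro sE hE
    have h : sE ≤ (2 * Real.sqrt κ * t ^ 2) ^ 2 := by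
      rw [show (2 * Real.sqrt κ * t ^ 2) ^ 2 = 4 * (Real.sqrt κ * Real.sqrt κ) * t ^ 4 by ring, wκ]
      exact hE.trans (by linarith [mul_nonneg hκ ht4])
    exact (Real.sqrt_le_sqrt h).trans (le_of_eq (Real.sqrt_sq (by positivity)))
  have rEp := rE hsEp
  have rEm := rE hsEm
  have rD : Real.sqrt sD ≤ 2 * Real.sqrt κ * t ^ 3 := by
    have h : sD ≤ (2 * Real.sqrt κ * t ^ 3) ^ 2 := by
      rw [show (2 * Real.sqrt κ * t ^ 3) ^ 2 = 4 * (Real.sqrt κ * Real.sqrt κ) * t ^ 6 by ring, wκ]; exact hsD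
    exact (Real.sqrt_le_sqrt h).trans (le_of_eq (Real.sqrt_sq (by positivity)))
  have nA := Real.sqrt_nonneg sA
  have nEp := Real.sqrt_nonneg sEp
  have nEm := Real.sqrt_nonneg sEm
  have nD := Real.sqrt_nonneg sD
  -- each term ≤ (poly in κ, √κ) · t⁴
  have b1 : |r4p| + |r4m| ≤ 27776916 * 2 * h4 * κ * t ^ 4 := by
    have h : ρ2 / 2 * (123 / 4 * κ * t ^ 2) ≤ 27776916 * h4 * κ * t ^ 4 := by
      have h0 : 0 ≤ 123 / 4 * κ * t ^ 2 := by positivity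
      calc ρ2 / 2 * (123 / 4 * κ * t ^ 2) ≤ 1806336 * h4 * t ^ 2 / 2 * (123 / 4 * κ * t ^ 2) :=
            mul_le_mul_of_nonneg_right (by linarith) h0
        _ = 27772416 * h4 * κ * t ^ 4 := by ring
        _ ≤ 27776916 * h4 * κ * t ^ 4 := by linarith [mul_nonneg (mul_nonneg hh4 hκ) ht4]
    linarith [hr4p.trans h, hr4m.trans h]
  have b2 : |trS| ≤ 15 * CG * h4 * t ^ 4 := htrS.trans (le_of_eq (by ring))
  have b3 : |tAD| ≤ 6 * κ * t ^ 4 := by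
    refine htAD.trans ?_
    calc Real.sqrt sA * Real.sqrt sD ≤ (3 * Real.sqrt κ * t) * (2 * Real.sqrt κ * t ^ 3) := mul_le_mul rA rD nD (by positivity)
      _ = 6 * (Real.sqrt κ * Real.sqrt κ) * t ^ 4 := by ring
      _ = 6 * κ * t ^ 4 := by rw [wκ]
  have b4 : |tEp2| + |tEm2| ≤ 5 * κ * t ^ 4 := by rw [qEp] at htEp2; rw [qEm] at htEm2; linarith
  have b5 : |tAAEp| + |tAAEm| ≤ 36 * κ * Real.sqrt κ * t ^ 4 := by
    rw [qA] at htAAEp htAAEm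
    have h : ∀ {sE : ℝ}, Real.sqrt sE ≤ 2 * Real.sqrt κ * t ^ 2 → sA * Real.sqrt sE ≤ 18 * κ * Real.sqrt κ * t ^ 4 := by
      intro sE hE
      calc sA * Real.sqrt sE ≤ (9 * κ * t ^ 2) * (2 * Real.sqrt κ * t ^ 2) := mul_le_mul hsA hE (Real.sqrt_nonneg _) (by positivity)
        _ = 18 * κ * Real.sqrt κ * t ^ 4 := by ring
    linarith [htAAEp.trans (h rEp), htAAEm.trans (h rEm)]
  have b6 : |tAEEp| + |tAEEm| ≤ 15 * κ * Real.sqrt κ * t ^ 4 := by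
    rw [mul_assoc, qEp] at htAEEp
    rw [mul_assoc, qEm] at htAEEm
    have h : ∀ {sE : ℝ}, 0 ≤ sE → sE ≤ 5 / 2 * κ * t ^ 4 → Real.sqrt sA * sE ≤ 15 / 2 * κ * Real.sqrt κ * t ^ 4 := by
      intro sE h0 hE
      have ht5 : t * t ^ 4 ≤ t ^ 4 := mul_le_of_le_one_left ht4 ht1
      calc Real.sqrt sA * sE ≤ (3 * Real.sqrt κ * t) * (5 / 2 * κ * t ^ 4) := mul_le_mul rA hE h0 (by positivity)
        _ = 15 / 2 * κ * Real.sqrt κ * (t * t ^ 4) := by ring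
        _ ≤ 15 / 2 * κ * Real.sqrt κ * t ^ 4 := mul_le_mul_of_nonneg_left ht5 (by positivity)
    linarith [htAEEp.trans (h hsEp0 hsEp), htAEEm.trans (h hsEm0 hsEm)]
  have b7 : |tE3p| + |tE3m| ≤ 10 * κ * Real.sqrt κ * t ^ 4 := by
    rw [qEp] at htE3p
    rw [qEm] at htE3m
    have h : ∀ {sE : ℝ}, sE ≤ 5 / 2 * κ * t ^ 4 → Real.sqrt sE ≤ 2 * Real.sqrt κ * t ^ 2 → sE * Real.sqrt sE ≤ 5 * κ * Real.sqrt κ * t ^ 4 := by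
      intro sE hE hr
      have ht6 : t ^ 4 * t ^ 2 ≤ t ^ 4 := mul_le_of_le_one_right ht4 ht2
      calc sE * Real.sqrt sE ≤ (5 / 2 * κ * t ^ 4) * (2 * Real.sqrt κ * t ^ 2) := mul_le_mul hE hr (Real.sqrt_nonneg _) (by positivity)
        _ = 5 * κ * Real.sqrt κ * (t ^ 4 * t ^ 2) := by ring
        _ ≤ 5 * κ * Real.sqrt κ * t ^ 4 := mul_le_mul_of_nonneg_left ht6 (by positivity)
    linarith [htE3p.trans (h hsEp rEp), htE3m.trans (h hsEm rEm)]
  have kk : κ * Real.sqrt κ * t ^ 4 ≤ (κ + κ ^ 2) / 2 * t ^ 4 := by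
    refine mul_le_mul_of_nonneg_right ?_ ht4
    calc κ * Real.sqrt κ ≤ κ * ((1 + κ) / 2) := mul_le_mul_of_nonneg_left wle hκ
      _ = (κ + κ ^ 2) / 2 := by ring
  have p1 := mul_nonneg hκ ht4
  have p2 := mul_nonneg (sq_nonneg κ) ht4
  have p3 := mul_nonneg (mul_nonneg hCG hh4) ht4
  have p4 := mul_nonneg (mul_nonneg hh4 hκ) ht4
  rw [abs_le]
  constructor
  · linarith [neg_abs_le r4p, neg_abs_le r4m, neg_abs_le trS, le_abs_self tAD, le_abs_self tEp2, le_abs_self tEm2, neg_abs_le tAAEp,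
      neg_abs_le tAAEm, neg_abs_le tAEEp, le_abs_self tAEEm, neg_abs_le tE3p, neg_abs_le tE3m]
  · linarith [le_abs_self r4p, le_abs_self r4m, le_abs_self trS, neg_abs_le tAD, neg_abs_le tEp2, neg_abs_le tEm2, le_abs_self tAAEp,
      le_abs_self tAAEm, le_abs_self tAEEp, neg_abs_le tAEEm, le_abs_self tE3p, le_abs_self tE3m]

end GhostTaylorProof

end Summit.QuantumFields.YangMills.Theorems.AllWindowsColdBoxBoxHighLine

end
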